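import Literature.NumberTheory.PAdicHodge.AinfRamifiedTorsionLift
import Literature.NumberTheory.PAdicHodge.AinfWeierstrassSupersingularTorsion
import Literature.NumberTheory.PAdicHodge.EisensteinRootShortModel
import HarnessLib

/-!
# Torsion SEPARATION over a ramified base: a nonzero `p`-torsion point of `Ŵ(𝔪_{ℂ_F})` has norm `> ‖ϖ‖` for the good
# supersingular `𝒪_D`-models of the K★ cells — the (L2′) input of the ω-period non-vanishing (N1′) (proofs only)

Topic `Literature/NumberTheory/PAdicHodge`; namespace `Literature.NumberTheory.PAdicHodge`. THEOREMS ONLY (no definition, no named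
fact, no instance, no `sorry`). Road item (R1) of the `p`-adic period programme (hDR on potentially supersingular curves over the
ramified base `𝒪_D = ℤ_p[ϖ]`, `ϖ^e = p`; BSD route EdixhovenFibreFiveSeven, crux K★ `stmt-BirchSwinnertonDyer-22226`).

WHY. For `ℤ`-models the non-vanishing `∫_τ ω ≠ 0` (file `AinfWeierstrassOmegaPeriodNonvanishing`) uses (L2): `[p]T = 0`, `T ∈ 𝔫`
`⇒ T ∈ p·𝔸_inf` (`[p] = pR + X^{p²}S`, `𝔸_inf/p` reduced). Over `A_inf(𝒪) = 𝔸_inf[ϖ]` the same step only gives `T ∈ ϖ·A_inf(𝒪)`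
(`AinfRamifiedVarpi`), i.e. `‖θ_𝒪(T)‖ ≤ ‖ϖ‖` for the `p`-torsion point `u = θ_𝒪(T)` of `Ŵ(𝔪_{ℂ_F})`; one then needs that NO nonzero
`p`-torsion point is that small. This file proves it by ultrametric domination of the linear term of
`[p](X) = p·f(X) + g(X^p)` (Silverman AEC IV.4.4 over every ring, tree `formalMul_prime_eq_add_expand`):

* §1 (any discrete coefficient ring `A`, any complete ultrametric `K` with `A → 𝒪_K`) `norm_evalAt_formalMul_prime_eq`:
  **`‖[p](t)‖ = ‖p‖·‖t‖`** as soon as `‖[X^p][p]‖·‖t‖^p < ‖p‖·‖t‖` and `‖t‖^{2p} < ‖p‖·‖t‖` (then `p·f(t)`, `‖f(t)‖ = ‖t‖`,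
  dominates `g(t^p) = [X^p][p]·t^p + t^{2p}·(…)`); hence `evalAt_formalMul_prime_ne_zero`.
* §2 (any `W` over `𝒪_D`, read in the discrete synonym `CoeffDisc D`, `D.poly = X^e − p`) `norm_coeff_prime_formalMul_le_of_hasseCoeff`:
  `A_p(W) ∈ ϱ^r·𝒪_D ⇒ ‖[X^p][p]_W‖ ≤ max(‖p‖, ‖ϖ‖^r)` (Katz–Mazur `[X^p][p] ≡ A_p (mod p)`, tree
  `coeff_prime_formalMul_sub_hasseCoeff_mem_span`); and the separation **`mulPC_ne_zero_of_norm_le_of_hasseCoeff`**: for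
  `u ∈ 𝔪_{ℂ_F}`, `u ≠ 0`, `‖u‖ ≤ ‖ϖ‖`: `[p]_W(u) ≠ 0`, provided `e < 2p − 1` and `e < r + (p − 1)`.
* §3 the models `W_D = ⟨0,0,0,a·ϱ^{r₄},b·ϱ^{r₆}⟩`: `A_5 = ϱ^{r₄}·32a`, `A_7 = ϱ^{r₆}·192b` (`hasseCoeff_model_{five,seven}`), hence the
  separation on the three K★ cells `(p; e, r₄, r₆) = (5; 3, 1, 0), (5; 6, 4, 0), (7; 4, 0, 2)` (`mulPC_model_{five,seven}_ne_zero`);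
  the (5; II*) cell, `e = 6 > p − 1`, is the one where the bare `A_p ≡ 0 (mod ϖ)` would not suffice (canonical subgroup).

## References
* [SilvermanAEC2009] J. H. Silverman, *AEC* (2009), IV.4.4 (`[p] = pf + g(X^p)`), IV.7, VII.3.
* [KatzMazur1985] N. Katz, B. Mazur, *Arithmetic moduli of elliptic curves* (1985), 12.4.2 (`[X^p][p] ≡` Hasse invariant).
* [Serre1972] J.-P. Serre, Invent. Math. 15 (1972), §1.11.
-/

noncomputable section

open PowerSeries Field ValuativeRel

namespace Literature.NumberTheory.PAdicHodge

open Literature Literature.NumberTheory.GaloisRepresentations Literature.NumberTheory.EllipticCurves WeierstrassCurve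
open Literature.NumberTheory.GaloisRepresentations.IsNonarchimedeanLocalField Literature.NumberTheory.GaloisRepresentations.LubinTate

/-! ## §1 `‖[p](t)‖ = ‖p‖·‖t‖` when the linear term dominates -/

section Generic

variable {A : Type*} [CommRing A] [UniformSpace A] [DiscreteUniformity A]
  {K : Type*} [NontriviallyNormedField K] [IsUltrametricDist K] [CompleteSpace K]
  [Algebra A (unitBall K)] [ContinuousSMul A (unitBall K)] {p : ℕ} [Fact p.Prime]

/-- `‖h(t)‖ ≤ 1`: values of `evalAt` lie in `𝒪_K`. [cite: SilvermanAEC2009, IV.7 and VII.3] -/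
private theorem norm_evalAt_le_one (t : (ballNilIdeal K).toIdeal) (h : PowerSeries A) :
    ‖((evalAt (ballNilIdeal K) t h : unitBall K) : K)‖ ≤ 1 :=
  NumberTheory.EllipticCurves.norm_coe_unitBall_le_one _

/-- **`‖f(t)‖ = ‖t‖` for `f = X + O(X²)`.** [cite: SilvermanAEC2009, IV.7 and VII.3] -/
theorem norm_evalAt_eq_norm_of_coeff_one (t : (ballNilIdeal K).toIdeal) {f : PowerSeries A} (hf0 : constantCoeff f = 0)
    (hf1 : coeff 1 f = 1) : ‖((evalAt (ballNilIdeal K) t f : unitBall K) : K)‖ = ‖((t : unitBall K) : K)‖ := by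
  obtain ⟨f', hf'⟩ := PowerSeries.X_dvd_iff.mpr hf0
  have hf'0 : constantCoeff f' = 1 := by
    have h := congrArg (coeff 1) hf'
    rw [hf1, PowerSeries.coeff_succ_X_mul, coeff_zero_eq_constantCoeff] at h
    exact h.symm
  obtain ⟨f₁, hf₁⟩ := PowerSeries.X_dvd_iff.mpr (show constantCoeff (f' - 1) = 0 by rw [map_sub, hf'0, map_one, sub_self])
  have hf'' : f = X * (1 + X * f₁) := by rw [← hf₁, add_sub_cancel, hf']
  have hsmall : ‖((evalAt (ballNilIdeal K) t (X * f₁) : unitBall K) : K)‖ < 1 :=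
    lt_of_le_of_lt (NumberTheory.EllipticCurves.norm_evalAt_le_of_constantCoeff t (by rw [map_mul, constantCoeff_X, zero_mul])) t.2
  have hone : ‖(1 : K) + (evalAt (ballNilIdeal K) t (X * f₁) : K)‖ = 1 := by
    rw [IsUltrametricDist.norm_add_eq_max_of_norm_ne_norm (by rw [norm_one]; exact (ne_of_lt hsmall).symm), norm_one,
      max_eq_left hsmall.le]
  rw [hf'', map_mul, map_add, map_one, NumberTheory.EllipticCurves.evalAt_X', Subring.coe_mul, Subring.coe_add, Subring.coe_one,
    norm_mul, hone, mul_one]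

variable (W : WeierstrassCurve A)

/-- **Domination of the linear term of `[p]`.** Write `[p](X) = p·f(X) + g(X^p)` (AEC IV.4.4), `f = X + O(X²)`, `g(0) = 0`,
`g'(0) = [X^p][p]`. If `‖[X^p][p]‖·‖t‖^p < ‖p‖·‖t‖` and `‖t‖^{2p} < ‖p‖·‖t‖` then **`‖[p](t)‖ = ‖p‖·‖t‖`**.
(Hypotheses: `f(0) = 0`, `f'(0) = 1` — automatic when `A` has no `p`-torsion.) [cite: SilvermanAEC2009, IV.4.4 and IV.7] -/
theorem norm_evalAt_formalMul_prime_eq (t : (ballNilIdeal K).toIdeal) (hf0 : constantCoeff (W.formalMulPPart p) = 0)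
    (hf1 : coeff 1 (W.formalMulPPart p) = 1)
    (h1 : ‖((algebraMap A (unitBall K) (coeff p (W.formalMul p)) : unitBall K) : K)‖ * ‖((t : unitBall K) : K)‖ ^ p <
      ‖(p : K)‖ * ‖((t : unitBall K) : K)‖)
    (h2 : ‖((t : unitBall K) : K)‖ ^ (2 * p) < ‖(p : K)‖ * ‖((t : unitBall K) : K)‖) :
    ‖((evalAt (ballNilIdeal K) t (W.formalMul p) : unitBall K) : K)‖ = ‖(p : K)‖ * ‖((t : unitBall K) : K)‖ := by
  have hp : p.Prime := Fact.out
  set x : K := ((t : unitBall K) : K) with hx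
  set g := W.formalMulFrobPart p with hg
  -- `g = g₁·X + X²·g₂`
  obtain ⟨g', hg'⟩ := PowerSeries.X_dvd_iff.mpr (W.constantCoeff_formalMulFrobPart p)
  obtain ⟨g₂, hg₂⟩ := PowerSeries.X_dvd_iff.mpr
    (show constantCoeff (g' - C (constantCoeff g')) = 0 by rw [map_sub, constantCoeff_C, sub_self])
  have hg₁ : constantCoeff g' = coeff p (W.formalMul p) := by
    have h := congrArg (coeff 1) hg'
    rw [PowerSeries.coeff_succ_X_mul, coeff_zero_eq_constantCoeff, coeff_one_formalMulFrobPart] at h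
    exact h.symm
  set c := coeff p (W.formalMul p) with hc
  have hg'dec : g' = C c + X * g₂ := by rw [← hg₁, ← hg₂]; ring
  have hgdec : g = C c * X + X ^ 2 * g₂ := by rw [hg, hg', hg'dec]; ring
  -- `expand p g = g₁·X^p + X^{2p}·expand p g₂`
  have hexp : PowerSeries.expand p hp.ne_zero g = C c * X ^ p + X ^ (2 * p) * PowerSeries.expand p hp.ne_zero g₂ := by
    rw [hgdec, map_add, map_mul, map_mul, map_pow, PowerSeries.expand_C, PowerSeries.expand_X, ← pow_mul]
    ring
  -- evaluate
  have heval : ((evalAt (ballNilIdeal K) t (W.formalMul p) : unitBall K) : K) =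
      (p : K) * (evalAt (ballNilIdeal K) t (W.formalMulPPart p) : K) +
        (((algebraMap A (unitBall K) c : unitBall K) : K) * x ^ p +
          x ^ (2 * p) * (evalAt (ballNilIdeal K) t (PowerSeries.expand p hp.ne_zero g₂) : K)) := by
    rw [W.formalMul_prime_eq_add_expand p, ← hg, hexp, map_add, map_mul, map_natCast, map_add, map_mul, map_mul, map_pow,
      map_pow, NumberTheory.EllipticCurves.evalAt_X', NumberTheory.EllipticCurves.evalAt_C']
    simp only [Subring.coe_add, Subring.coe_mul, SubmonoidClass.coe_pow, Subring.coe_natCast, hx]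
  have hmain : ‖(p : K) * (evalAt (ballNilIdeal K) t (W.formalMulPPart p) : K)‖ = ‖(p : K)‖ * ‖x‖ := by
    rw [norm_mul, norm_evalAt_eq_norm_of_coeff_one t hf0 hf1]
  have hrest : ‖((algebraMap A (unitBall K) c : unitBall K) : K) * x ^ p +
      x ^ (2 * p) * (evalAt (ballNilIdeal K) t (PowerSeries.expand p hp.ne_zero g₂) : K)‖ < ‖(p : K)‖ * ‖x‖ := by
    refine lt_of_le_of_lt (IsUltrametricDist.norm_add_le_max _ _) (max_lt ?_ ?_)
    · rw [norm_mul, norm_pow]; exact h1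
    · rw [norm_mul, norm_pow]
      exact lt_of_le_of_lt (mul_le_of_le_one_right (by positivity) (norm_evalAt_le_one t _)) h2
  rw [heval, IsUltrametricDist.norm_add_eq_max_of_norm_ne_norm (by rw [hmain]; exact (ne_of_lt hrest).symm), hmain,
    max_eq_left hrest.le]

/-- **Separation**: under the domination hypotheses, `[p](t) ≠ 0` (they force `t ≠ 0` and `‖p‖ > 0`).
[cite: SilvermanAEC2009, IV.4.4 and IV.7] -/
theorem evalAt_formalMul_prime_ne_zero (t : (ballNilIdeal K).toIdeal) (hf0 : constantCoeff (W.formalMulPPart p) = 0)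
    (hf1 : coeff 1 (W.formalMulPPart p) = 1)
    (h1 : ‖((algebraMap A (unitBall K) (coeff p (W.formalMul p)) : unitBall K) : K)‖ * ‖((t : unitBall K) : K)‖ ^ p <
      ‖(p : K)‖ * ‖((t : unitBall K) : K)‖)
    (h2 : ‖((t : unitBall K) : K)‖ ^ (2 * p) < ‖(p : K)‖ * ‖((t : unitBall K) : K)‖) :
    ((evalAt (ballNilIdeal K) t (W.formalMul p) : unitBall K) : K) ≠ 0 := by
  have hpos : 0 < ‖(p : K)‖ * ‖((t : unitBall K) : K)‖ := lt_of_le_of_lt (by positivity) h2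
  rw [← norm_pos_iff, norm_evalAt_formalMul_prime_eq W t hf0 hf1 h1 h2]
  exact hpos

end Generic

/-! ## §2 The models over `𝒪_D`: `‖[X^p][p]‖ ≤ max(‖p‖, ‖ϖ‖^r)` and the separation below `‖ϖ‖` -/

section Model

variable {F : Type} [Field F] [ValuativeRel F] [TopologicalSpace F] [IsNonarchimedeanLocalField F] [CharZero F]
  {p : ℕ} [Fact p.Prime] {hp : valuation F p < 1} {D : EisensteinRoot F p hp}

/-- `f'(0) = 1` in `[p] = p·f + g(X^p)` over `𝒪_D` (no `p`-torsion; `[X][p] = p`). [cite: SilvermanAEC2009, IV.4.4] -/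
theorem coeff_one_formalMulPPart_coeffDisc (W : WeierstrassCurve (EisensteinRoot.CoeffDisc D)) :
    coeff 1 (W.formalMulPPart p) = 1 := by
  have hpr : p.Prime := Fact.out
  have h := congrArg (coeff 1) (W.formalMul_prime_eq_add_expand p)
  rw [W.coeff_one_formalMul' p, map_add, ← map_natCast (C (R := EisensteinRoot.CoeffDisc D)) p, PowerSeries.coeff_C_mul,
    PowerSeries.coeff_expand, if_neg (fun h1 : p ∣ 1 => hpr.one_lt.ne' (Nat.dvd_one.1 h1)), add_zero] at h
  have h0 : (p : EisensteinRoot.CoeffDisc D) * (coeff 1 (W.formalMulPPart p) - 1) = 0 := by rw [mul_sub, ← h, mul_one, sub_self]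
  exact sub_eq_zero.1 (EisensteinRoot.CoeffDisc.eq_zero_of_natCast_mul_eq_zero h0)

/-- Norm in `ℂ_F` of `ϱ^r ∈ 𝒪_D`: `‖ϖ‖^r`. [cite: SerreLocalFields1979, Ch. I §6 Prop. 18] -/
theorem norm_algebraMap_coeffDisc_root_pow (r : ℕ) :
    ‖((algebraMap (EisensteinRoot.CoeffDisc D) (CBall F) (EisensteinRoot.CoeffDisc.of D (AdjoinRoot.root D.poly ^ r)) : CBall F) :
        CompletedAlgClosure F)‖ = ‖((D.rootC : integerC F) : CompletedAlgClosure F)‖ ^ r := by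
  rw [EisensteinRoot.coe_algebraMap_coeffDisc_cBall, map_pow, EisensteinRoot.Coeff.toF_root, map_pow, norm_pow, EisensteinRoot.coe_rootC]

/-- An element of `p𝒪_D + x𝒪_D` has norm `≤ max(‖p‖, ‖x‖)` in `ℂ_F`. [cite: SerreLocalFields1979, Ch. II §1] -/
theorem norm_algebraMap_coeffDisc_le_max_of_sub_mem_span {y x : EisensteinRoot.CoeffDisc D}
    (h : y - x ∈ Ideal.span {(p : EisensteinRoot.CoeffDisc D)}) :
    ‖((algebraMap (EisensteinRoot.CoeffDisc D) (CBall F) y : CBall F) : CompletedAlgClosure F)‖ ≤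
      max ‖(p : CompletedAlgClosure F)‖ ‖((algebraMap (EisensteinRoot.CoeffDisc D) (CBall F) x : CBall F) : CompletedAlgClosure F)‖ := by
  obtain ⟨c, hc⟩ := Ideal.mem_span_singleton'.1 h
  have hy : y = c * p + x := by rw [hc]; ring
  rw [hy, map_add, map_mul, map_natCast, Subring.coe_add, Subring.coe_mul, Subring.coe_natCast]
  refine (IsUltrametricDist.norm_add_le_max _ _).trans (max_le_max ?_ le_rfl)
  rw [norm_mul]
  exact mul_le_of_le_one_left (norm_nonneg _) (NumberTheory.EllipticCurves.norm_coe_unitBall_le_one _)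

variable (W : WeierstrassCurve (EisensteinRoot.CoeffDisc D))

/-- **`‖[X^p][p]_W‖ ≤ max(‖p‖, ‖ϖ‖^r)` when `A_p(W) ∈ ϱ^r·𝒪_D`** (`p` odd): `[X^p][p] ≡ A_p (mod p)` (Katz–Mazur 12.4.2, tree
`coeff_prime_formalMul_sub_hasseCoeff_mem_span`). [cite: KatzMazur1985, 12.4.2] [cite: SilvermanAEC2009, V.4.1] -/
theorem norm_coeff_prime_formalMul_le_of_hasseCoeff (hp2 : p ≠ 2) {r : ℕ} {c : EisensteinRoot.CoeffDisc D}
    (hA : W.hasseCoeff p = EisensteinRoot.CoeffDisc.of D (AdjoinRoot.root D.poly ^ r) * c) :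
    ‖((algebraMap (EisensteinRoot.CoeffDisc D) (CBall F) (coeff p (W.formalMul p)) : CBall F) : CompletedAlgClosure F)‖ ≤
      max ‖(p : CompletedAlgClosure F)‖ (‖((D.rootC : integerC F) : CompletedAlgClosure F)‖ ^ r) := by
  refine (norm_algebraMap_coeffDisc_le_max_of_sub_mem_span (W.coeff_prime_formalMul_sub_hasseCoeff_mem_span p hp2)).trans
    (max_le_max le_rfl ?_)
  rw [hA, map_mul, Subring.coe_mul, norm_mul, norm_algebraMap_coeffDisc_root_pow]
  exact mul_le_of_le_one_right (by positivity) (NumberTheory.EllipticCurves.norm_coe_unitBall_le_one _)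

/-- **Torsion separation below `‖ϖ‖`.** For `W` over `𝒪_D` (`D.poly = X^e − p`, `p` odd) with `A_p(W) ∈ ϱ^r·𝒪_D`, `e < 2p − 1`
and `e < r + (p − 1)`: every `u ∈ 𝔪_{ℂ_F}` with `u ≠ 0` and `‖u‖ ≤ ‖ϖ‖` has **`[p]_W(u) ≠ 0`** — no nonzero `p`-torsion point
of `Ŵ(𝔪_{ℂ_F})` lies in the ball of radius `‖ϖ‖`. (`‖ϖ‖^e = ‖p‖`: `‖u‖^{2p−1} ≤ ‖p‖^{(2p−1)/e} < ‖p‖` and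
`‖[X^p][p]‖·‖u‖^{p−1} ≤ max(‖p‖, ‖ϖ‖^r)·‖ϖ‖^{p−1} < ‖p‖`.) On the K★ cells `(p; e, r) = (5; 3, 1), (5; 6, 4), (7; 4, 2)` the
hypotheses hold; the (5; II*) cell (`e = 6 > p − 1`) is where the bare `A_p ≡ 0 (mod ϖ)` would not suffice.
[cite: SilvermanAEC2009, IV.4.4 and IV.7] [cite: KatzMazur1985, 12.4.2] -/
theorem mulPC_ne_zero_of_norm_le_of_hasseCoeff {e : ℕ} (hD : D.poly = Polynomial.X ^ e - Polynomial.C (p : ℤ_[p])) (hp2 : p ≠ 2)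
    {r : ℕ} {c : EisensteinRoot.CoeffDisc D} (hA : W.hasseCoeff p = EisensteinRoot.CoeffDisc.of D (AdjoinRoot.root D.poly ^ r) * c)
    (he2 : e < 2 * p - 1) (her : e < r + (p - 1))
    (u : (maxNilIdealC F).toIdeal) (hu0 : ((u : CBall F) : CompletedAlgClosure F) ≠ 0)
    (hu : ‖((u : CBall F) : CompletedAlgClosure F)‖ ≤ ‖((D.rootC : integerC F) : CompletedAlgClosure F)‖) :
    ((AinfRamTop.mulPC W u : (maxNilIdealC F).toIdeal) : CBall F) ≠ 0 := by
  have hpr : p.Prime := Fact.out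
  have hp2' : 2 ≤ p := hpr.two_le
  -- norms of `p`, `ϖ`, `u`
  set x : CompletedAlgClosure F := ((u : CBall F) : CompletedAlgClosure F) with hx
  set π : ℝ := ‖((D.rootC : integerC F) : CompletedAlgClosure F)‖ with hπ
  have heD : D.e = e := D.e_eq_of_poly_eq hD
  have hπe : π ^ e = ‖(p : CompletedAlgClosure F)‖ := by rw [hπ, ← heD]; exact D.norm_rootC_pow
  have hπ1 : π < 1 := D.norm_rootC_lt_one
  have hx0 : 0 < ‖x‖ := norm_pos_iff.2 hu0
  have hπ0 : 0 < π := lt_of_lt_of_le hx0 hu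
  have hp0 : 0 < ‖(p : CompletedAlgClosure F)‖ := by rw [← hπe]; positivity
  -- `π^n < ‖p‖` as soon as `n > e`
  have hπlt : ∀ {n : ℕ}, e < n → π ^ n < ‖(p : CompletedAlgClosure F)‖ := fun {n} hn => by
    rw [← hπe]; exact pow_lt_pow_right_of_lt_one₀ hπ0 hπ1 hn
  have hxπ : ∀ n : ℕ, ‖x‖ ^ n ≤ π ^ n := fun n => pow_le_pow_left₀ (norm_nonneg _) hu n
  intro h0
  have h0' : ((evalAt (maxNilIdealC F) u (W.formalMul p) : CBall F) : CompletedAlgClosure F) = 0 := by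
    rw [← coe_evalPt₁_eq_evalAt (maxNilIdealC F) (W.formalMul p) (W.constantCoeff_formalMul p) u]
    exact congrArg (fun z : CBall F => (z : CompletedAlgClosure F)) h0 |>.trans rfl
  -- `‖[X^p][p]‖·‖u‖^p < ‖p‖·‖u‖`
  have h1 : ‖((algebraMap (EisensteinRoot.CoeffDisc D) (CBall F) (coeff p (W.formalMul p)) : CBall F) : CompletedAlgClosure F)‖ *
      ‖x‖ ^ p < ‖(p : CompletedAlgClosure F)‖ * ‖x‖ := by
    have hc := norm_coeff_prime_formalMul_le_of_hasseCoeff W hp2 hA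
    have hpow : ‖x‖ ^ p = ‖x‖ ^ (p - 1) * ‖x‖ := by rw [← pow_succ, Nat.sub_add_cancel hpr.one_le]
    rw [hpow, ← mul_assoc]
    refine mul_lt_mul_of_pos_right ?_ hx0
    refine lt_of_le_of_lt (mul_le_mul hc (hxπ (p - 1)) (by positivity) (by positivity)) ?_
    rcases le_or_gt ‖(p : CompletedAlgClosure F)‖ (π ^ r) with hle | hgt
    · rw [max_eq_right hle, ← pow_add]
      exact hπlt (n := r + (p - 1)) (by omega)
    · rw [max_eq_left hgt.le]
      calc ‖(p : CompletedAlgClosure F)‖ * π ^ (p - 1) < ‖(p : CompletedAlgClosure F)‖ * 1 :=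
            mul_lt_mul_of_pos_left (pow_lt_one₀ hπ0.le hπ1 (by omega)) hp0
        _ = _ := mul_one _
  -- `‖u‖^{2p} < ‖p‖·‖u‖`
  have h2 : ‖x‖ ^ (2 * p) < ‖(p : CompletedAlgClosure F)‖ * ‖x‖ := by
    have hpow : ‖x‖ ^ (2 * p) = ‖x‖ ^ (2 * p - 1) * ‖x‖ := by rw [← pow_succ, Nat.sub_add_cancel (by omega)]
    rw [hpow]
    exact mul_lt_mul_of_pos_right (lt_of_le_of_lt (hxπ _) (hπlt (n := 2 * p - 1) (by omega))) hx0
  exact evalAt_formalMul_prime_ne_zero (K := CompletedAlgClosure F) W u (constantCoeff_formalMulPPart W)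
    (coeff_one_formalMulPPart_coeffDisc W) h1 h2 h0'

end Model

/-! ## §3 The explicit models of the K★ cells -/

section Cells

variable {F : Type} [Field F] [ValuativeRel F] [TopologicalSpace F] [IsNonarchimedeanLocalField F] [CharZero F]

/-- `A_5 = ϱ^{r₄}·(32 a)` for the model `⟨0,0,0,a ϱ^{r₄}, b ϱ^{r₆}⟩` over `𝒪_D` (read in `CoeffDisc D`). [cite: SilvermanAEC2009, V.4.1] -/
theorem hasseCoeff_model_five [Fact (5 : ℕ).Prime] {hp : valuation F (5 : ℕ) < 1} {D : EisensteinRoot F 5 hp}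
    (a b : ℤ_[5]) (r₄ r₆ : ℕ) :
    ((⟨0, 0, 0, AdjoinRoot.of D.poly a * AdjoinRoot.root D.poly ^ r₄, AdjoinRoot.of D.poly b * AdjoinRoot.root D.poly ^ r₆⟩ :
        WeierstrassCurve D.Coeff).map (EisensteinRoot.CoeffDisc.of D).toRingHom).hasseCoeff 5 =
      EisensteinRoot.CoeffDisc.of D (AdjoinRoot.root D.poly ^ r₄) * EisensteinRoot.CoeffDisc.of D (32 * AdjoinRoot.of D.poly a) := by
  rw [WeierstrassCurve.map_hasseCoeff, hasseCoeff_five_short, RingEquiv.toRingHom_eq_coe, RingHom.coe_coe, ← map_mul]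
  congr 1; ring

/-- `A_7 = ϱ^{r₆}·(192 b)` for the model `⟨0,0,0,a ϱ^{r₄}, b ϱ^{r₆}⟩` over `𝒪_D` (read in `CoeffDisc D`). [cite: SilvermanAEC2009, V.4.1] -/
theorem hasseCoeff_model_seven [Fact (7 : ℕ).Prime] {hp : valuation F (7 : ℕ) < 1} {D : EisensteinRoot F 7 hp}
    (a b : ℤ_[7]) (r₄ r₆ : ℕ) :
    ((⟨0, 0, 0, AdjoinRoot.of D.poly a * AdjoinRoot.root D.poly ^ r₄, AdjoinRoot.of D.poly b * AdjoinRoot.root D.poly ^ r₆⟩ :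
        WeierstrassCurve D.Coeff).map (EisensteinRoot.CoeffDisc.of D).toRingHom).hasseCoeff 7 =
      EisensteinRoot.CoeffDisc.of D (AdjoinRoot.root D.poly ^ r₆) * EisensteinRoot.CoeffDisc.of D (192 * AdjoinRoot.of D.poly b) := by
  rw [WeierstrassCurve.map_hasseCoeff, hasseCoeff_seven_short, RingEquiv.toRingHom_eq_coe, RingHom.coe_coe, ← map_mul]
  congr 1; ring

/-- **Separation on the two K★ cells at `5`**: models `(e, r₄) = (3, 1)` (IV*) and `(6, 4)` (II*) over `𝒪_D = ℤ_5[X]/(X^e − 5)`: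
no nonzero `5`-torsion point of `Ŵ_D(𝔪_{ℂ_F})` has norm `≤ ‖ϖ‖`. [cite: SilvermanAEC2009, IV.4.4 and IV.7] -/
theorem mulPC_model_five_ne_zero [Fact (5 : ℕ).Prime] {hp : valuation F (5 : ℕ) < 1} {D : EisensteinRoot F 5 hp} {e : ℕ}
    (hD : D.poly = Polynomial.X ^ e - Polynomial.C ((5 : ℕ) : ℤ_[5])) (a b : ℤ_[5]) {r₄ : ℕ} (r₆ : ℕ)
    (hcell : e = 3 ∧ r₄ = 1 ∨ e = 6 ∧ r₄ = 4)
    (u : (maxNilIdealC F).toIdeal) (hu0 : ((u : CBall F) : CompletedAlgClosure F) ≠ 0)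
    (hu : ‖((u : CBall F) : CompletedAlgClosure F)‖ ≤ ‖((D.rootC : integerC F) : CompletedAlgClosure F)‖) :
    ((AinfRamTop.mulPC (((⟨0, 0, 0, AdjoinRoot.of D.poly a * AdjoinRoot.root D.poly ^ r₄,
        AdjoinRoot.of D.poly b * AdjoinRoot.root D.poly ^ r₆⟩ : WeierstrassCurve D.Coeff).map
        (EisensteinRoot.CoeffDisc.of D).toRingHom)) u : (maxNilIdealC F).toIdeal) : CBall F) ≠ 0 :=
  mulPC_ne_zero_of_norm_le_of_hasseCoeff _ hD (by norm_num) (hasseCoeff_model_five a b r₄ r₆)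
    (by rcases hcell with ⟨rfl, -⟩ | ⟨rfl, -⟩ <;> norm_num) (by rcases hcell with ⟨rfl, rfl⟩ | ⟨rfl, rfl⟩ <;> norm_num) u hu0 hu

/-- **Separation on the K★ cell at `7`**: model `(e, r₆) = (4, 2)` (III*) over `𝒪_D = ℤ_7[X]/(X^4 − 7)`: no nonzero `7`-torsion
point of `Ŵ_D(𝔪_{ℂ_F})` has norm `≤ ‖ϖ‖`. [cite: SilvermanAEC2009, IV.4.4 and IV.7] -/
theorem mulPC_model_seven_ne_zero [Fact (7 : ℕ).Prime] {hp : valuation F (7 : ℕ) < 1} {D : EisensteinRoot F 7 hp} {e : ℕ}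
    (hD : D.poly = Polynomial.X ^ e - Polynomial.C ((7 : ℕ) : ℤ_[7])) (a b : ℤ_[7]) (r₄ : ℕ) {r₆ : ℕ} (hcell : e = 4 ∧ r₆ = 2)
    (u : (maxNilIdealC F).toIdeal) (hu0 : ((u : CBall F) : CompletedAlgClosure F) ≠ 0)
    (hu : ‖((u : CBall F) : CompletedAlgClosure F)‖ ≤ ‖((D.rootC : integerC F) : CompletedAlgClosure F)‖) :
    ((AinfRamTop.mulPC (((⟨0, 0, 0, AdjoinRoot.of D.poly a * AdjoinRoot.root D.poly ^ r₄,
        AdjoinRoot.of D.poly b * AdjoinRoot.root D.poly ^ r₆⟩ : WeierstrassCurve D.Coeff).map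
        (EisensteinRoot.CoeffDisc.of D).toRingHom)) u : (maxNilIdealC F).toIdeal) : CBall F) ≠ 0 :=
  mulPC_ne_zero_of_norm_le_of_hasseCoeff _ hD (by norm_num) (hasseCoeff_model_seven a b r₄ r₆)
    (by rcases hcell with ⟨rfl, -⟩; norm_num) (by rcases hcell with ⟨rfl, rfl⟩; norm_num) u hu0 hu

end Cells



end Literature.NumberTheory.PAdicHodge

end
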